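import Summits.BirchSwinnertonDyer.BirchSwinnertonDyer.Theorems.PrintX8SmallImageRiderMainConjecture
import Summits.BirchSwinnertonDyer.BirchSwinnertonDyer.Theorems.PrintX8SmallImageRiderBothColours
import Summits.BirchSwinnertonDyer.BirchSwinnertonDyer.Theses.PrintX8
import HarnessLib

/-!
# Route `PrintX8`, crux `SharpFlatMuAnSmallImageX8` (stmt-BirchSwinnertonDyer-20714, the analytic rider) BY NAME,
# analytic rank `0`: the rider + its held inputs (`InputSharpFlatMuTransfer`, item 20771) + the published
# inputs give, on the small-image X8 pairs of rank `0`, the integral Euler-system half (60 cells), `BSD(E,3)`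
# where `3 ∤ #Ш_an` (54 cells), and there Sprung's Main Conjecture 7.21 and K1's predicate for BOTH colours
# — the statements of items 20402 and 19875 on that sub-population, WITHOUT K1
# (cell `bsd-print-x8`, seat p3 gen 2; `--supports` 20714; theorems only, closes nothing)

PARTITION (cell bsd-print-x8, leaf `ClassX8`): class-level readings of the route decls
`Theses.PrintX8.SharpFlatMuAnSmallImageX8` (20714) and `Theses.PrintX8.InputSharpFlatMuTransfer` (20771)
CONDITIONAL on published named facts; closes NONE; 0 census cells move; BSD is not proved by any of
this. beyond-print theorem: no (bookkeeping over parts 1–4; the beyond-print content is part 1's integral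
bound at non-surjective image).

HONEST FRAMING. Since rev 11 the `μ`-crux 20622 is SPLIT into the rider An (20714, = Perrin-Riou 2003 Conj.
7.1 on the class, OPEN; per pair ONE certified Mazur–Tate layer per parity, ty3 g2: 61/61) and the held
inputs 20771, glued by p1's transfer (20716, CLOSED). Parts 1–4 of this seat (p548892, p550798, p551403,
p552409) showed what the rider buys at analytic rank `0` WITHOUT K1. This file states it ON THE ROUTE
DECLS BY NAME, so the planner / tribunal can read the reach of 20714 directly:
* §13 `upperHalf_smallImage_rankZero_of_sharpFlatMuAnSmallImageX8` — An + 20771 + Pub ⟹ `ord₃ #Ш ≤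
  ord₃ #Ш_an` on every X8 pair with `ρ̄_{E,3}` not onto and `r_an = 0` (60 cells; with p2's surj form the
  Euler-system half on ALL of X8 ∩ {r_an = 0});
* §14 `bsdp_smallImage_rankZero_shaUnit_of_sharpFlatMuAnSmallImageX8` — ⟹ `BSD(E,3)` on the 54 of them with
  `3 ∤ #Ш_an` (K1 redundant there);
* §15 `sharpFlatMainConjecture_smallImage_rankZero_shaUnit_of_sharpFlatMuAnSmallImageX8` — ⟹ Sprung's Main
  Conj. 7.21 AND K1's predicate for every colour there = items 20402 ∧ 19875 restricted to X8 ∩ {¬surj(3)}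
  ∩ {r_an = 0} ∩ {3 ∤ #Ш_an}.
So on that sub-population the leaf `WAllCornerX8` ⟸ An + held/published inputs ALONE; the residual of the
small-image branch beyond An is the 6 rank-`0` cells with `3 ∣ #Ш_an` (lower half: K1, or part 3's descent
line — 5 of them) and the rank-`1` cell. Nothing here changes `closes`; items stay class-wide.

References: [PerrinRiou2003] Conj. 7.1 (p. 170); [Sprung2012] Thm. 7.14, Thm. 7.16, Main Conj. 7.21
(pp. 1504–1505); [Sprung2024] §5.2 Lemmas 5.5–5.9; [Miller2011LMS] Def. 1.1; tree: parts 1–4, p1 g2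
`PrintX8SharpFlatMuTransfer` / `…MuDefect`, p3 g1 `PrintX8MazurTateMuRider`, ty3 g2
`Rank1Residual/PrintX8/CertificateMazurTate*.lean` (the per-cell layer certificates).
-/

set_option autoImplicit false
-- justification: the mandated namespace `Summit.BirchSwinnertonDyer.BirchSwinnertonDyer.Theorems`
-- (single-conjunct summit, Sub = Summit) repeats a segment by design (D-0017).
set_option linter.dupNamespace false

noncomputable section

open scoped Classical NumberField MatrixGroups ModularForm

open NumberField IsDedekindDomain WeierstrassCurve CongruenceSubgroup Field
  Literature.NumberTheory.EllipticCurves Literature.NumberTheory.EllipticCurves.ModularForms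
  Literature.NumberTheory.EllipticCurves.Rank1Residual
  Literature.NumberTheory.EllipticCurves.Rank1Residual.Typed
  Literature.NumberTheory.EllipticCurves.Sprung2017 Literature.NumberTheory.EllipticCurves.Sprung2012
  Literature.NumberTheory.EllipticCurves.Sprung2024
  Literature.NumberTheory.EllipticCurves.GreenbergVatsal2000
  Literature.NumberTheory.EllipticCurves.ZpExtension
  Summit.BirchSwinnertonDyer.BirchSwinnertonDyer.Theorems
  Summit.BirchSwinnertonDyer.BirchSwinnertonDyer.Theorems.PrintX8SmallImageRiderRankZero
  Summit.BirchSwinnertonDyer.BirchSwinnertonDyer.Theorems.PrintX8SmallImageRiderMainConjecture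
  Summit.BirchSwinnertonDyer.BirchSwinnertonDyer.Theorems.PrintX8SmallImageRiderBothColours
  Summit.BirchSwinnertonDyer.BirchSwinnertonDyer.Theses.PrintX8
  Summit.BirchSwinnertonDyer.Rank1Residual.Supersingular

namespace Summit.BirchSwinnertonDyer.BirchSwinnertonDyer.Theorems.PrintX8SmallImageMuAnRankZero

/-- The rider item 20714 (every NON-ZERO colour has unit content) yields the ONE-colour rider shape of
parts 2/4 (some colour has unit content) at every rank-`0` small-image X8 pair: one colour of the Sprung
pair is non-zero (Sprung 2012 Prop. 6.14, `IsSprungPair.exists_chromaticL_ne_zero`). Bookkeeping.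
[cite: Sprung2012, Prop. 6.14 (p. 1498)] [cite: PerrinRiou2003, Conj. 7.1 (p. 170)] -/
theorem oneColourRider_of_sharpFlatMuAnSmallImageX8 (hAn : SharpFlatMuAnSmallImageX8) :
    ∀ (W : WeierstrassCurve ℚ) [W.IsElliptic] [W.IsGloballyMinimal] (p : ℕ) [Fact p.Prime],
      ClassX8 W p → ¬ Surj W p → W.analyticRank = 0 →
      ∀ (N : ℕ) (_ : NeZero N) (f : CuspForm (Gamma0 N) 2) (Lsharp Lflat : IwasawaAlgebra p),
      IsNewformOf W f → IsSprungPair f p (W.frobeniusTrace p) Lsharp Lflat →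
      ∃ col₀ : Chroma, HasUnitContent (chromaticL col₀ Lsharp Lflat) := by
  intro W _ _ p _ hX hns _h0 N hN f Lsharp Lflat hf hSP
  haveI := hN
  have hp3 : p = 3 := hX.1
  subst hp3
  obtain ⟨col₀, hcol₀⟩ := hSP.exists_chromaticL_ne_zero hf hX.2.1.1
  exact ⟨col₀, hAn W 3 hX hns col₀ N hN f Lsharp Lflat hf hSP hcol₀⟩

/-! ### §13 An BY NAME ⟹ the upper half on the rank-`0` small-image pairs (60 cells) -/

/-- **Item 20714 (An) + item 20771 (`InputSharpFlatMuTransfer` = `hCK` ∧ period unit at `3`) + the published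
inputs ⟹ `ord₃ #Ш ≤ ord₃ #Ш_an` on EVERY X8 pair with `ρ̄_{E,3}` NOT onto and `r_an = 0`** (60 census
cells) — part 2's `upperHalf_smallImage_rankZero_of_oneColourRider` fed by the rider item. Named inputs:
modularity `hmodf`, Sprung 2012 Thm. 2.2 / 7.14 / 7.16 (rational clause), Sprung 2024 §5.2, GZK, `hmod`.
NO K1, NO `Surj`. Conditional; closes nothing. [cite: Sprung2012, Thm. 2.2, Thm. 7.14 and Thm. 7.16 (p. 1504)]
[cite: Sprung2024, §5.2 Lemmas 5.5–5.9 (pp. 40–41)] [cite: PerrinRiou2003, Conj. 7.1 (p. 170)] [cite: Miller2011LMS, Def. 1.1] -/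
theorem upperHalf_smallImage_rankZero_of_sharpFlatMuAnSmallImageX8
    (hmodf : exists_isNewformOf) (h22 : thm22_exists_isHondaSystem)
    (h714 : thm714_sharpFlatSelmerDual_finite_torsion) (h716 : thm716_sharpFlatCharIdeal_divisibility)
    (h59 : lem59AllN_sharpFlatCharValue_rankZero)
    (hGZK : rank_eq_analyticRank_of_analyticRank_le_one) (hmod : hasEntireLFunction_rat)
    (hIn : InputSharpFlatMuTransfer) (hAn : SharpFlatMuAnSmallImageX8) :
    ∀ (W : WeierstrassCurve ℚ) [W.IsElliptic] [W.IsGloballyMinimal] (p : ℕ) [Fact p.Prime],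
      ClassX8 W p → ¬ Surj W p → W.analyticRank = 0 → MissingUpperBoundAt W p :=
  upperHalf_smallImage_rankZero_of_oneColourRider hmodf h22 h714 h716 hIn.1 h59 hIn.2 hGZK hmod
    (oneColourRider_of_sharpFlatMuAnSmallImageX8 hAn)

/-! ### §14 An BY NAME ⟹ `BSD(E,3)` on X8 ∩ {¬surj(3)} ∩ {r_an = 0} ∩ {3 ∤ #Ш_an} (54 cells) -/

/-- **Item 20714 (An) + item 20771 + the published inputs ⟹ Miller's `BSD(E,3)` on every X8 pair with
`ρ̄_{E,3}` NOT onto, `r_an = 0` and `ord₃ #Ш_an ≤ 0`** — 54 of the 61 small-image census cells; the route's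
K1 binder is REDUNDANT there (lower half vacuous). Conditional; closes nothing.
[cite: Sprung2012, Thm. 7.14 and Thm. 7.16 (p. 1504)] [cite: Sprung2024, §5.2 Lemmas 5.5–5.9]
[cite: PerrinRiou2003, Conj. 7.1 (p. 170)] [cite: Miller2011LMS, §1 and Def. 1.1] -/
theorem bsdp_smallImage_rankZero_shaUnit_of_sharpFlatMuAnSmallImageX8
    (hmodf : exists_isNewformOf) (h22 : thm22_exists_isHondaSystem)
    (h714 : thm714_sharpFlatSelmerDual_finite_torsion) (h716 : thm716_sharpFlatCharIdeal_divisibility)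
    (h59 : lem59AllN_sharpFlatCharValue_rankZero)
    (hGZK : rank_eq_analyticRank_of_analyticRank_le_one) (hmod : hasEntireLFunction_rat)
    (hIn : InputSharpFlatMuTransfer) (hAn : SharpFlatMuAnSmallImageX8) :
    ∀ (W : WeierstrassCurve ℚ) [W.IsElliptic] [W.IsGloballyMinimal] (p : ℕ) [Fact p.Prime],
      ClassX8 W p → ¬ Surj W p → W.analyticRank = 0 →
      (∃ q : ℚ, shaAn W = (q : ℂ) ∧ padicValRat p q ≤ 0) → BSDp W p :=
  bsdp_smallImage_rankZero_shaUnit_of_oneColourRider hmodf h22 h714 h716 hIn.1 h59 hIn.2 hGZK hmod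
    (oneColourRider_of_sharpFlatMuAnSmallImageX8 hAn)

/-! ### §15 An BY NAME ⟹ items 20402 ∧ 19875 on that sub-population (Main Conj. 7.21 + K1's predicate,
both colours) -/

/-- **Item 20714 (An) + item 20771 + the published inputs ⟹ on every X8 pair with `ρ̄_{E,3}` NOT onto,
`r_an = 0` and `ord₃ #Ш_an ≤ 0`, for EVERY colour `•`: Sprung's Main Conjecture 7.21 for `(E, 3, •)`
(`SprungSharpFlatMainConjecture W 3 •`, the statement of item 20402 there) AND its Eisenstein half
(`SprungSharpFlatLowerDivisibility W 3 •`, the statement of item 19875 = K1 there)** — part 4's one-colour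
class form fed by the rider item. So on 54 of the 61 small-image cells the leaf needs NOTHING beyond An +
held/published inputs. Named inputs: `h22`, `h714`, `h716`, `h59`, GZK, `hmod` (+ `hIn` = `hCK` ∧ `h3`).
Conditional; closes nothing; items stay class-wide. [cite: Sprung2012, Main Conj. 1.3 (p. 1486) and Main Conj. 7.21 (p. 1505)]
[cite: PerrinRiou2003, Conj. 7.1 (p. 170)] [cite: Sprung2024, §5.2 Lemmas 5.5–5.9] [cite: Miller2011LMS, Def. 1.1] -/
theorem sharpFlatMainConjecture_smallImage_rankZero_shaUnit_of_sharpFlatMuAnSmallImageX8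
    (h22 : thm22_exists_isHondaSystem)
    (h714 : thm714_sharpFlatSelmerDual_finite_torsion) (h716 : thm716_sharpFlatCharIdeal_divisibility)
    (h59 : lem59AllN_sharpFlatCharValue_rankZero)
    (hGZK : rank_eq_analyticRank_of_analyticRank_le_one) (hmod : hasEntireLFunction_rat)
    (hIn : InputSharpFlatMuTransfer) (hAn : SharpFlatMuAnSmallImageX8) :
    ∀ (W : WeierstrassCurve ℚ) [W.IsElliptic] [W.IsGloballyMinimal] (p : ℕ) [Fact p.Prime],
      ClassX8 W p → ¬ Surj W p → W.analyticRank = 0 →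
      (∃ q : ℚ, shaAn W = (q : ℂ) ∧ padicValRat p q ≤ 0) →
      ∀ col : Chroma, SprungSharpFlatMainConjecture W p col ∧ SprungSharpFlatLowerDivisibility W p col :=
  sharpFlatMainConjecture_smallImage_rankZero_shaUnit_of_oneColourRider h22 hIn.1 h714 h716 h59 hIn.2 hGZK
    hmod (oneColourRider_of_sharpFlatMuAnSmallImageX8 hAn)

/-- **The same reading with the route's split spelled out: An (20714) + 20771 ⟹ Mu (20622, via the CLOSED glue
20716 BY NAME) — and An ALSO closes `BSD(E,3)` and the ♯/♭ main conjecture (both colours, with its Eisenstein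
half) on the rank-`0` small-image cells with `3 ∤ #Ш_an`, which Mu + K1 were filed to do.** Bookkeeping
conjunction for the planner. [cite: PerrinRiou2003, Conj. 7.1 (p. 170)] [cite: Sprung2012, Main Conj. 7.21 (p. 1505)]
[cite: Miller2011LMS, Def. 1.1] -/
theorem muBound_and_smallImage_rankZero_shaUnit_of_sharpFlatMuAnSmallImageX8
    (hmodf : exists_isNewformOf) (h22 : thm22_exists_isHondaSystem)
    (h714 : thm714_sharpFlatSelmerDual_finite_torsion) (h716 : thm716_sharpFlatCharIdeal_divisibility)
    (h59 : lem59AllN_sharpFlatCharValue_rankZero)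
    (hGZK : rank_eq_analyticRank_of_analyticRank_le_one) (hmod : hasEntireLFunction_rat)
    (hGlue : GlueMuAnSmallImageX8) (hIn : InputSharpFlatMuTransfer) (hAn : SharpFlatMuAnSmallImageX8) :
    MuBoundSmallImageX8 ∧
      ∀ (W : WeierstrassCurve ℚ) [W.IsElliptic] [W.IsGloballyMinimal] (p : ℕ) [Fact p.Prime],
        ClassX8 W p → ¬ Surj W p → W.analyticRank = 0 →
        (∃ q : ℚ, shaAn W = (q : ℂ) ∧ padicValRat p q ≤ 0) →
        BSDp W p ∧ ∀ col : Chroma,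
          SprungSharpFlatMainConjecture W p col ∧ SprungSharpFlatLowerDivisibility W p col :=
  ⟨hGlue hAn hIn, fun W _ _ p _ hX hns h0 hsha ↦
    ⟨bsdp_smallImage_rankZero_shaUnit_of_sharpFlatMuAnSmallImageX8 hmodf h22 h714 h716 h59 hGZK hmod hIn hAn
        W p hX hns h0 hsha,
      sharpFlatMainConjecture_smallImage_rankZero_shaUnit_of_sharpFlatMuAnSmallImageX8 h22 h714 h716 h59 hGZK
        hmod hIn hAn W p hX hns h0 hsha⟩⟩

end Summit.BirchSwinnertonDyer.BirchSwinnertonDyer.Theorems.PrintX8SmallImageMuAnRankZero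

end
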